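import Literature.AnabelianGeometry.AbsoluteAnabelian.AbsTopIThm26iiiClauseOneOpen
import Literature.AnabelianGeometry.AbsoluteAnabelian.AbsTopIThm26SplitModelInstances
import Literature.AnabelianGeometry.AbsoluteAnabelian.AbsTopIThm26UniversalClosuresRefuted
import Literature.AnabelianGeometry.AbsoluteAnabelian.AbsTopIDeltaOneFreeProlRankProofs
import Literature.AnabelianGeometry.AbsoluteAnabelian.AbsTopIThm26ivProofs
import Literature.AnabelianGeometry.AbsoluteAnabelian.MLFGaloisGroupsHolds
import Literature.AnabelianGeometry.AbsoluteAnabelian.ProfiniteRankProofs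
import Literature.AnabelianGeometry.SemiGraphs.ProSigmaCompletionTFG
import Literature.AnabelianGeometry.SemiGraphs.ProSigmaCompletionModels
import HarnessLib

/-!
# [AbsTopI] Thm 2.6 (iii) AS TYPED: the universal closure of `Thm26iii` is REFUTED even under the
# printed group-theoretic standing hypotheses — PROOF-ONLY

S. Mochizuki, *Topics in Absolute Anabelian Geometry I: Generalities*, J. Math. Sci. Univ. Tokyo
**19** (2012) [AbsTopI], Thm 2.6 (iii) p. 22 [cite: MochizukiAbsTopI2012, Thm 2.6 (iii) p.22].

The statement file `AbsTopIThm26iii.lean` (abc-iut-L4-t4) types (iii) as a PREDICATE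
`FundamentalExtension.Thm26iii E S` ("`θ²(Π) ⊆ Σ`, with equality if `|θ¹(Π)| ≥ 2`") on an
ABSTRACT extension of profinite groups `1 → Δ → Π → G → 1` and a free set of primes `S`.  Its first
clause is a theorem of the tree under the printed standing hypotheses — MLF base data `G ≅ G_K`,
"`Π` topologically finitely generated" (Thm 2.6 (ii)), "`Δ` pro-`Σ`" —
(`FundamentalExtension.thetaSet_two_subset_of_isProSet`, `AbsTopIThm26iiiClauseOneProofs.lean`).
This companion, in the format of `AbsTopIThm26UniversalClosuresRefuted.lean` (F-0246/7/8), records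
that the SECOND clause is a hypothesis on data:

* `FundamentalExtension.exists_mlfBase_not_thm26iii` — GIVEN "`G_{ℚ₃}` topologically finitely
  generated" ([NSW] Thm 7.5.10; a theorem of the tree Summits-side,
  `isTopologicallyFinitelyGenerated_absoluteGaloisGroup_padic`), there is an extension WITH MLF base
  data (`K = ℚ₃`), `Π` and `Δ` topologically finitely generated (Prop 2.2), `Δ` pro-`S` for
  `S = {3, 2} ⊆ Primes`, and `|θ¹(Π)| ≥ 2`, for which `Thm26iii E S` FAILS.  Witness: the split
  model `Π := Δ̂ × G_{ℚ₃} ↠ G_{ℚ₃}` of `AbsTopIThm26SplitModelInstances.lean` with `Δ̂` a pro-`{2}`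
  completion of the free group `F₂`: `δ¹₃(Π) ≥ δ¹₃(G_{ℚ₃}) = 2` (rank formula `freeProlRank_gal`)
  and `δ¹₂(Π) = δ¹₂(G_{ℚ₃}) + 2 ≥ 2` (`freeProlRank_prod_eq_add_of_isProSigmaCompletion_freeGroup`),
  so `{2, 3} ⊆ θ¹(Π)`; `Δ` is pro-`{2}`, hence pro-`{3, 2}`, but `3 ∉ θ²(Π)` by the first clause for
  `{2}` — the typed predicate is not monotone in `S`
  (`FundamentalExtension.not_thm26iii_insert_of_isProSet`).
* `FundamentalExtension.not_forall_mlfBase_thm26iii` — the universal closure over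
  ⟨`E`, MLF base, `S ⊆ Primes`, `Π` tfg, `Δ` tfg, `Δ` pro-`S`⟩ is FALSE (same hypothesis).

HONEST FRAMING: in print `Σ` is pinned by `Δ := Δ_X^Σ` (the maximal pro-`Σ` quotient of the
geometric fundamental group of a hyperbolic orbicurve, p. 21) and the second clause rests on
Lemma 2.7 (iii) (the Albanese); a refuted universal closure says the typed row is a HYPOTHESIS ON
DATA (admissible at instances of geometric origin), not that anything in print is false.  Nothing
here bears on [IUTchIII] Cor. 3.12; typed ≠ proved.  Theorems only; axioms standard.
-/

noncomputable section

open Topology Field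

namespace Literature.AnabelianGeometry.AbsoluteAnabelian

open Literature.AnabelianGeometry.SemiGraphs.SemiGraphOfAnabelioids

/-- `l ∈ θ¹(Π)` for a compact `Π` as soon as `δ¹_l(Π) = freeProlRank Π l ≥ 2` (take the open subgroup
`⊤` in the supremum `ε¹_l(Π)`). [cite: MochizukiAbsTopI2012, Thm 2.6 p.21] -/
theorem mem_thetaSet_one_of_two_le_freeProlRank {G : Type} [Group G] [TopologicalSpace G]
    [IsTopologicalGroup G] [CompactSpace G] (l : ℕ) [hl : Fact l.Prime]
    (h : (2 : ℕ∞) ≤ freeProlRank G l) : l ∈ thetaSet G 1 := by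
  refine ⟨hl.out, ?_⟩
  have h2 : ((3 - 1 : ℕ) : ℕ∞) = 2 := by norm_num
  rw [h2, epsilonInv_one_eq_iSup_freeProlRank]
  refine le_iSup₂_of_le (⊤ : Subgroup G) (by rw [Subgroup.coe_top]; exact isOpen_univ) ?_
  rw [freeProlRank_top]
  exact h

namespace FundamentalExtension

/-- **The universal closure of the typed [AbsTopI] Thm 2.6 (iii) is FALSE even among extensions
with MLF base data, `Π` and `Δ` topologically finitely generated, `Δ` pro-`S` and `|θ¹(Π)| ≥ 2`**,
GIVEN `G_{ℚ₃}` topologically finitely generated ([NSW] Thm 7.5.10, Summits-side theorem of the tree).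
Witness: the split model `Π := Δ̂ × G_{ℚ₃} ↠ G_{ℚ₃}`, `Δ̂` a pro-`{2}` completion of `F₂`,
`S = {3, 2}`: `{2, 3} ⊆ θ¹(Π)` (`δ¹₃(Π) ≥ δ¹₃(G_{ℚ₃}) = 2`, `δ¹₂(Π) = δ¹₂(G_{ℚ₃}) + 2`), `Δ`
pro-`{2}` so pro-`{3, 2}`, while `3 ∉ θ²(Π) ⊆ {2}` (first clause): the second clause
"`θ²(Π) = {3, 2}`" fails. [cite: MochizukiAbsTopI2012, Thm 2.6 (iii) p.22] -/
theorem exists_mlfBase_not_thm26iii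
    (hG : IsTopologicallyFinitelyGenerated (absoluteGaloisGroup ℚ_[3])) :
    ∃ (E : FundamentalExtension.{0}) (_ : E.MLFBase) (S : Set ℕ), S ⊆ {q | q.Prime} ∧
      IsTopologicallyFinitelyGenerated E.arith ∧ E.GeomTFG ∧ IsProSet E.geom S ∧
      2 ≤ (thetaSet E.arith 1).encard ∧ ¬ E.Thm26iii S := by
  classical
  obtain ⟨P, ι, hι⟩ :=
    IsProSigmaCompletion.exists_isProSigmaCompletion (FreeGroup (Fin 2)) ({2} : Set ℕ)
  let E : FundamentalExtension.{0} :=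
    ⟨ProfiniteGrp.of (P × absoluteGaloisGroup ℚ_[3]), absoluteGaloisGrp ℚ_[3],
      ContinuousMonoidHom.snd P (absoluteGaloisGroup ℚ_[3]), Prod.snd_surjective⟩
  let B : E.MLFBase := { p := 3, K := ℚ_[3], galIso := ContinuousMulEquiv.refl _ }
  obtain ⟨j, hj⟩ := exists_surjective_toGeom_split P ℚ_[3]
  have hP : IsTopologicallyFinitelyGenerated P :=
    IsProSigmaCompletion.isTopologicallyFinitelyGenerated_of_fg hι
  have hΔ : E.GeomTFG := hP.of_surjective j hj
  have htfg : IsTopologicallyFinitelyGenerated E.arith :=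
    IsTopologicallyFinitelyGenerated.of_extension
      (ContinuousMonoidHom.snd P (absoluteGaloisGroup ℚ_[3])) Prod.snd_surjective hΔ hG
  have hpro2 : IsProSet E.geom ({2} : Set ℕ) :=
    (isProSet_of_isProSigmaCompletion hι).of_surjective j hj
  have hpro : IsProSet E.geom ({3, 2} : Set ℕ) := hpro2.mono (Set.subset_insert 3 {2})
  -- `δ¹₃(Π) ≥ δ¹₃(G_{ℚ₃}) = [ℚ₃ : ℚ₃] + 1 = 2`
  have h3 : (2 : ℕ∞) ≤ freeProlRank E.arith 3 := by
    have hg : freeProlRank E.gal 3 = ((Module.finrank ℚ_[3] ℚ_[3] + 1 : ℕ) : ℕ∞) :=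
      (freeProlRank_gal B).2
    rw [Module.finrank_self] at hg
    calc (2 : ℕ∞) = freeProlRank E.gal 3 := by rw [hg]; norm_num
      _ ≤ freeProlRank E.arith 3 := freeProlRank_le_of_surjective E.aug E.aug_surjective 3
  -- `δ¹₂(Π) = δ¹₂(G_{ℚ₃}) + 2 ≥ 2`
  have h2 : (2 : ℕ∞) ≤ freeProlRank E.arith 2 := by
    have hprod : freeProlRank (P × absoluteGaloisGroup ℚ_[3]) 2 =
        freeProlRank (absoluteGaloisGroup ℚ_[3]) 2 + 2 :=
      freeProlRank_prod_eq_add_of_isProSigmaCompletion_freeGroup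
        (B := absoluteGaloisGroup ℚ_[3]) hι 2 (Set.mem_singleton 2)
    change (2 : ℕ∞) ≤ freeProlRank (P × absoluteGaloisGroup ℚ_[3]) 2
    rw [hprod]
    exact le_add_self
  -- `{2, 3} ⊆ θ¹(Π)`, so `|θ¹(Π)| ≥ 2`
  have hθ : 2 ≤ (thetaSet E.arith 1).encard := by
    have hsub : ({2, 3} : Set ℕ) ⊆ thetaSet E.arith 1 := by
      intro l hl
      rcases hl with rfl | rfl
      · exact mem_thetaSet_one_of_two_le_freeProlRank (G := E.arith) 2 h2
      · exact mem_thetaSet_one_of_two_le_freeProlRank (G := E.arith) 3 h3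
    calc (2 : ℕ∞) = ({2, 3} : Set ℕ).encard := (Set.encard_pair (by decide)).symm
      _ ≤ (thetaSet E.arith 1).encard := Set.encard_le_encard hsub
  refine ⟨E, B, {3, 2}, ?_, htfg, hΔ, hpro, hθ, ?_⟩
  · intro q hq
    rcases hq with rfl | rfl
    · exact Nat.prime_three
    · exact Nat.prime_two
  · exact E.not_thm26iii_insert_of_isProSet B htfg hpro2 hθ Nat.prime_three (by simp)

/-- **The universal closure of the typed [AbsTopI] Thm 2.6 (iii) over ⟨extension with MLF base data,
`S ⊆ Primes`, `Π` tfg, `Δ` tfg, `Δ` pro-`S`⟩ is FALSE**, GIVEN `G_{ℚ₃}` topologically finitely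
generated: the row `Thm26iii` is a hypothesis on data (geometric origin: `Δ = Δ_X^Σ`, Lemma 2.7
(iii)), admissible at instances — its first clause being a theorem
(`thetaSet_two_subset_of_isProSet`). [cite: MochizukiAbsTopI2012, Thm 2.6 (iii) p.22] -/
theorem not_forall_mlfBase_thm26iii
    (hG : IsTopologicallyFinitelyGenerated (absoluteGaloisGroup ℚ_[3])) :
    ¬ ∀ (E : FundamentalExtension.{0}) (_ : E.MLFBase) (S : Set ℕ), S ⊆ {q | q.Prime} →
        IsTopologicallyFinitelyGenerated E.arith → E.GeomTFG → IsProSet E.geom S →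
          E.Thm26iii S := by
  intro h
  obtain ⟨E, B, S, hS, htfg, hΔ, hpro, -, hnot⟩ := exists_mlfBase_not_thm26iii hG
  exact hnot (h E B S hS htfg hΔ hpro)

end FundamentalExtension

end Literature.AnabelianGeometry.AbsoluteAnabelian

end
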